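import Mathlib
import HarnessLib
import Summits.Ventures.LatticeQCDFlow.Exactness.AlcoveGapChartSUN
import Summits.Ventures.LatticeQCDFlow.Exactness.StickBreakingSUN
import Summits.Ventures.LatticeQCDFlow.Exactness.SUNSpectralCouplingLayerBooked

/-!
# The `SU(N)` spectral kernel in box coordinates, every `N`: box flow `χ` on `(0,1)ⁿ` → stick-breaking `φ` → gap chart `Z` → alcove; exact with exactly the booked density `D(χa)·Jχ(a)/D(a) · |Δ(e^{ix'})|²/|Δ(e^{ix})|²`

HONEST FRAMING: exact (Metropolis-corrected) sampling algorithms for lattice gauge theory;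
figures of merit are autocorrelation/cost numbers at stated couplings and volumes; no
continuum-physics claim.

Venture `LatticeQCDFlow` (cell pub-lqcd), topic `Exactness`; FANOUT row 10 (`eng-equiv`, engine
`latflow.equiv` `spectral.spectral_kernel`, general `N`, `cell = 'simplex'`; Boyda et al., PRD 103 (2021)
074504 §III.C, App. B Algorithm 2).  NEW WORK of the cell: the every-`N` version of
`SU3SpectralKernelBookedBoxFlow.lean`, composing `StickBreakingSUN.lean` (`(0,1)ⁿ → Δ°`),
`AlcoveGapChartSUN.lean` (`Δ° → A`, Boyda's `ζ` up to a relabelling of the simplex vertices) and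
`SUNSpectralCouplingLayerBooked.lean`.  The alcove map `G = Z ∘ φ ∘ χ ∘ φ⁻¹ ∘ Z⁻¹` and its Jacobian are
CONSTRUCTED here; only left inverses of the charts are needed.  Nothing is cited as a fact; no number;
no definition (`φ`, `Z` through characterising hypotheses).

## What is typed (`B = (0,1)ⁿ`, `Δ°`, `A`, `D(a) = |∏_i ∏_{j<i}(1 − a_j)|`, `x(θ) = Fin.snoc θ (−Σθ)`)

* `stickBreaking_leftInverse_sun`, `gapChart_leftInverse_sun`, `gapChart_stickBreaking_mem_alcove_sun`,
  `exists_box_of_mem_alcove_sun`;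
* **`hasJacobian_spectralKernel_sun_booked_boxFlow`** — `χ` a box flow with `HasJacobian (Leb|_B) χ Jχ`
  and `χ(B) ⊆ B`; `f` measurable (no continuity), permutation-equivariant, preserving unimodularity
  and unit product, with `f(e^{i x(Zφa)}) = e^{i x(Zφ(χa))}` for `a ∈ B`; ANY kernel `h` following the
  spectral recipe of `f`; ANY `J` (measurability is automatic, `measurable_of_spectral`) which is a symmetric measurable function `JD` of the spectrum
  with, for `a ∈ B`, `JD(e^{ix(Zφa)})·|Δ(e^{ix(Zφa)})|²/(n+1)! = (D(χa)·Jχ(a)/D(a))·|Δ(e^{ix(Zφ(χa))})|²/(n+1)!`.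
  Then `HasJacobian (Haar SU(n+1)) h J`.
-/

noncomputable section

namespace Summit.Ventures.LatticeQCDFlow.Exactness

open MeasureTheory Matrix Set Real Finset
open Literature.LinearAlgebra.Matrix
open Literature.MathematicalPhysics.QuantumFieldTheory (haarProbability)
open scoped ENNReal

variable {n : ℕ}

section Charts

variable {φ Z : (Fin n → ℝ) → (Fin n → ℝ)}
  (hφ : ∀ a i, φ a i = a i * ∏ j ∈ Finset.Iio i, (1 - a j))
  (hZ : ∀ ρ i, Z ρ i = -(2 * π / (n + 1)) * (∑ k : Fin n, ((n : ℝ) - k) * ρ k) + 2 * π * ∑ k ∈ Finset.Iio i, ρ k)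

include hφ in
/-- `φ⁻¹ ∘ φ = id` on the open box, with `φ⁻¹(ρ)_i = ρ_i / (1 − Σ_{j<i} ρ_j)`. -/
theorem stickBreaking_leftInverse_sun {a : Fin n → ℝ} (ha : a ∈ Set.pi univ fun _ : Fin n => Ioo (0 : ℝ) 1) :
    (fun i => φ a i / (1 - ∑ j ∈ Finset.Iio i, φ a j)) = a := by
  funext i
  rw [sum_Iio_stickBreaking hφ, hφ, sub_sub_cancel]
  have hpos : 0 < ∏ j ∈ Finset.Iio i, (1 - a j) :=
    Finset.prod_pos fun j _ => by have := (Set.mem_univ_pi.mp ha) j; linarith [this.2]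
  exact mul_div_cancel_right₀ (a i) hpos.ne'

include hZ in
/-- `Z⁻¹ ∘ Z = id`, with `Z⁻¹(θ)_k = (x(θ)_{k+1} − x(θ)_k)/2π`. -/
theorem gapChart_leftInverse_sun (ρ : Fin n → ℝ) :
    (fun k : Fin n => ((Fin.snoc (Z ρ) (-∑ k, Z ρ k) : Fin (n + 1) → ℝ) k.succ -
      (Fin.snoc (Z ρ) (-∑ k, Z ρ k) : Fin (n + 1) → ℝ) k.castSucc) / (2 * π)) = ρ := by
  funext k
  rw [gap_gapChart hZ]
  have hπ : (2 * π) ≠ 0 := by positivity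
  field_simp

include hφ hZ in
/-- `Z ∘ φ` maps the open box into the alcove. -/
theorem gapChart_stickBreaking_mem_alcove_sun {a : Fin n → ℝ} (ha : a ∈ Set.pi univ fun _ : Fin n => Ioo (0 : ℝ) 1) :
    StrictMono (Fin.snoc (Z (φ a)) (-∑ k, Z (φ a) k) : Fin (n + 1) → ℝ) ∧
      (Fin.snoc (Z (φ a)) (-∑ k, Z (φ a) k) : Fin (n + 1) → ℝ) (Fin.last n) <
        (Fin.snoc (Z (φ a)) (-∑ k, Z (φ a) k) : Fin (n + 1) → ℝ) 0 + 2 * π := by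
  have hρ : φ a ∈ {ρ : Fin n → ℝ | (∀ k, 0 < ρ k) ∧ ∑ k, ρ k < 1} := by
    rw [← image_stickBreaking_sun hφ]
    exact ⟨a, ha, rfl⟩
  have hθ : Z (φ a) ∈ {θ : Fin n → ℝ | StrictMono (Fin.snoc θ (-∑ k, θ k) : Fin (n + 1) → ℝ) ∧
      (Fin.snoc θ (-∑ k, θ k) : Fin (n + 1) → ℝ) (Fin.last n) < (Fin.snoc θ (-∑ k, θ k) : Fin (n + 1) → ℝ) 0 + 2 * π} := by
    rw [← image_gapChart hZ]
    exact ⟨φ a, hρ, rfl⟩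
  exact hθ

include hφ hZ in
/-- Every point of the alcove is `Z(φ a)` for some `a` in the open box. -/
theorem exists_box_of_mem_alcove_sun {θ : Fin n → ℝ} (hmono : StrictMono (Fin.snoc θ (-∑ k, θ k) : Fin (n + 1) → ℝ))
    (hlast : (Fin.snoc θ (-∑ k, θ k) : Fin (n + 1) → ℝ) (Fin.last n) < (Fin.snoc θ (-∑ k, θ k) : Fin (n + 1) → ℝ) 0 + 2 * π) :
    ∃ a ∈ Set.pi univ (fun _ : Fin n => Ioo (0 : ℝ) 1), Z (φ a) = θ := by
  have hθ : θ ∈ Z '' {ρ : Fin n → ℝ | (∀ k, 0 < ρ k) ∧ ∑ k, ρ k < 1} := by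
    rw [image_gapChart hZ]
    exact ⟨hmono, hlast⟩
  obtain ⟨ρ, hρ, rfl⟩ := hθ
  have hρ' : ρ ∈ φ '' (Set.pi univ fun _ : Fin n => Ioo (0 : ℝ) 1) := by
    rw [image_stickBreaking_sun hφ]
    exact hρ
  obtain ⟨a, ha, rfl⟩ := hρ'
  exact ⟨a, ha, rfl⟩

end Charts

/-! ## The kernel in box coordinates, every `N` -/

section Booked

variable {E : (Fin n → ℝ) → specialDiagonalTorus (Fin (n + 1))}
  (hE : ∀ θ (i : Fin (n + 1)), (((E θ : specialDiagonalTorus (Fin (n + 1))) : Matrix.specialUnitaryGroup (Fin (n + 1)) ℂ) :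
    Matrix (Fin (n + 1)) (Fin (n + 1)) ℂ) i i = (Circle.exp ((Fin.snoc θ (-∑ k, θ k) : Fin (n + 1) → ℝ) i) : ℂ))
  {P : Equiv.Perm (Fin (n + 1)) → specialDiagonalTorus (Fin (n + 1)) → specialDiagonalTorus (Fin (n + 1))}
  (hP : ∀ σ t i, (((P σ t : specialDiagonalTorus (Fin (n + 1))) : Matrix.specialUnitaryGroup (Fin (n + 1)) ℂ) :
    Matrix (Fin (n + 1)) (Fin (n + 1)) ℂ) i i =
      ((t : Matrix.specialUnitaryGroup (Fin (n + 1)) ℂ) : Matrix (Fin (n + 1)) (Fin (n + 1)) ℂ) (σ i) (σ i))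
  {φ Z : (Fin n → ℝ) → (Fin n → ℝ)}
  (hφ : ∀ a i, φ a i = a i * ∏ j ∈ Finset.Iio i, (1 - a j))
  (hZ : ∀ ρ i, Z ρ i = -(2 * π / (n + 1)) * (∑ k : Fin n, ((n : ℝ) - k) * ρ k) + 2 * π * ∑ k ∈ Finset.Iio i, ρ k)

include hE hP hφ hZ

/-- **The `SU(n+1)` spectral kernel in box coordinates is an exact transport of Haar with exactly the
booked density, every `N`.**  `χ` a box flow on `B = (0,1)ⁿ` with `HasJacobian (Leb|_B) χ Jχ` mapping `B`
into itself; `f` measurable (no continuity), permutation-equivariant, preserving unimodularity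
and unit product, with `f(e^{i x(Zφa)}) = e^{i x(Zφ(χa))}` for `a ∈ B`; `h` ANY kernel following the
spectral recipe of `f`; `J` ANY density (measurable automatically), a symmetric measurable function `JD` of the spectrum
with the booked box-coordinate value (`D(a) = |∏_i ∏_{j<i}(1 − a_j)|`):
`JD(e^{ix(Zφa)})·D(e^{ix(Zφa)}) = (D(χa)·Jχ(a)/D(a))·D(e^{ix(Zφ(χa))})`.  Then `HasJacobian (Haar SU(n+1)) h J`. -/
theorem hasJacobian_spectralKernel_sun_booked_boxFlow
    {f : (Fin (n + 1) → ℂ) → (Fin (n + 1) → ℂ)} (hfm : Measurable f)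
    (hfperm : ∀ (σ : Equiv.Perm (Fin (n + 1))) (d : Fin (n + 1) → ℂ), (∀ i, ‖d i‖ = 1) →
      f (fun i => d (σ i)) = fun i => f d (σ i))
    {χ : (Fin n → ℝ) → (Fin n → ℝ)} {Jχ : (Fin n → ℝ) → ℝ≥0∞}
    (hχ : HasJacobian ((volume : Measure (Fin n → ℝ)).restrict (Set.pi univ fun _ : Fin n => Ioo (0 : ℝ) 1)) χ Jχ)
    (hχbox : ∀ a ∈ Set.pi univ (fun _ : Fin n => Ioo (0 : ℝ) 1), χ a ∈ Set.pi univ fun _ : Fin n => Ioo (0 : ℝ) 1)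
    (hfG : ∀ a ∈ Set.pi univ (fun _ : Fin n => Ioo (0 : ℝ) 1),
      f (fun i => (Circle.exp ((Fin.snoc (Z (φ a)) (-∑ k, Z (φ a) k) : Fin (n + 1) → ℝ) i) : ℂ)) =
        fun i => (Circle.exp ((Fin.snoc (Z (φ (χ a))) (-∑ k, Z (φ (χ a)) k) : Fin (n + 1) → ℝ) i) : ℂ))
    {h : Matrix.specialUnitaryGroup (Fin (n + 1)) ℂ → Matrix.specialUnitaryGroup (Fin (n + 1)) ℂ}
    (hagree : ∀ (Q : Matrix.specialUnitaryGroup (Fin (n + 1)) ℂ) (V : Matrix (Fin (n + 1)) (Fin (n + 1)) ℂ)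
      (d : Fin (n + 1) → ℂ), V ∈ Matrix.unitaryGroup (Fin (n + 1)) ℂ →
        (Q : Matrix (Fin (n + 1)) (Fin (n + 1)) ℂ) = V * diagonal d * star V →
        ((h Q : Matrix.specialUnitaryGroup (Fin (n + 1)) ℂ) : Matrix (Fin (n + 1)) (Fin (n + 1)) ℂ) =
          V * diagonal (f d) * star V)
    (hf1 : ∀ d : Fin (n + 1) → ℂ, (∀ i, ‖d i‖ = 1) → ∀ i, ‖f d i‖ = 1)
    (hfdet : ∀ d : Fin (n + 1) → ℂ, (∀ i, ‖d i‖ = 1) → ∏ i, d i = 1 → ∏ i, f d i = 1)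
    {JD : (Fin (n + 1) → ℂ) → ℝ≥0∞} (hJDm : Measurable JD)
    (hJDperm : ∀ (σ : Equiv.Perm (Fin (n + 1))) (d : Fin (n + 1) → ℂ), JD (fun i => d (σ i)) = JD d)
    (hJchart : ∀ a ∈ Set.pi univ (fun _ : Fin n => Ioo (0 : ℝ) 1),
      JD (fun i => (Circle.exp ((Fin.snoc (Z (φ a)) (-∑ k, Z (φ a) k) : Fin (n + 1) → ℝ) i) : ℂ)) *
          ENNReal.ofReal ((∏ i, ∏ k ∈ Finset.univ.erase i,
            ‖(Circle.exp ((Fin.snoc (Z (φ a)) (-∑ k, Z (φ a) k) : Fin (n + 1) → ℝ) i) : ℂ) -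
              (Circle.exp ((Fin.snoc (Z (φ a)) (-∑ k, Z (φ a) k) : Fin (n + 1) → ℝ) k) : ℂ)‖) /
                (Fintype.card (Fin (n + 1))).factorial) =
        (ENNReal.ofReal |∏ i : Fin n, ∏ j ∈ Finset.Iio i, (1 - (χ a) j)| * Jχ a /
            ENNReal.ofReal |∏ i : Fin n, ∏ j ∈ Finset.Iio i, (1 - a j)|) *
          ENNReal.ofReal ((∏ i, ∏ k ∈ Finset.univ.erase i,
            ‖(Circle.exp ((Fin.snoc (Z (φ (χ a))) (-∑ k, Z (φ (χ a)) k) : Fin (n + 1) → ℝ) i) : ℂ) -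
              (Circle.exp ((Fin.snoc (Z (φ (χ a))) (-∑ k, Z (φ (χ a)) k) : Fin (n + 1) → ℝ) k) : ℂ)‖) /
                (Fintype.card (Fin (n + 1))).factorial))
    {J : Matrix.specialUnitaryGroup (Fin (n + 1)) ℂ → ℝ≥0∞}
    (hJspec : ∀ (W : Matrix.specialUnitaryGroup (Fin (n + 1)) ℂ) (V : Matrix (Fin (n + 1)) (Fin (n + 1)) ℂ) (d : Fin (n + 1) → ℂ),
      V ∈ Matrix.unitaryGroup (Fin (n + 1)) ℂ → (W : Matrix (Fin (n + 1)) (Fin (n + 1)) ℂ) = V * diagonal d * star V →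
        J W = JD d) :
    HasJacobian (haarProbability (Matrix.specialUnitaryGroup (Fin (n + 1)) ℂ)) h J := by
  -- left-inverse charts
  set φi : (Fin n → ℝ) → (Fin n → ℝ) := fun ρ i => ρ i / (1 - ∑ j ∈ Finset.Iio i, ρ j) with hφi
  set ζi : (Fin n → ℝ) → (Fin n → ℝ) := fun θ k => ((Fin.snoc θ (-∑ k, θ k) : Fin (n + 1) → ℝ) k.succ -
    (Fin.snoc θ (-∑ k, θ k) : Fin (n + 1) → ℝ) k.castSucc) / (2 * π) with hζi
  have hleftφ : ∀ a ∈ Set.pi univ (fun _ : Fin n => Ioo (0 : ℝ) 1), φi (φ a) = a :=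
    fun a ha => stickBreaking_leftInverse_sun hφ ha
  have hleftζ : ∀ ρ, ζi (Z ρ) = ρ := fun ρ => gapChart_leftInverse_sun hZ ρ
  -- measurability
  have hφm : Measurable φ := by
    rw [show φ = fun a i => a i * ∏ j ∈ Finset.Iio i, (1 - a j) from funext fun a => funext fun i => hφ a i]
    exact measurable_pi_lambda _ fun i => (measurable_pi_apply i).mul
      (Finset.measurable_prod _ fun j _ => measurable_const.sub (measurable_pi_apply j))
  have hZm : Measurable Z := by
    rw [show Z = fun ρ i => -(2 * π / (n + 1)) * (∑ k : Fin n, ((n : ℝ) - k) * ρ k) + 2 * π * ∑ k ∈ Finset.Iio i, ρ k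
      from funext fun ρ => funext fun i => hZ ρ i]
    exact measurable_pi_lambda _ fun i => (measurable_const.mul (Finset.measurable_sum _ fun k _ =>
      measurable_const.mul (measurable_pi_apply k))).add (measurable_const.mul (Finset.measurable_sum _ fun k _ =>
        measurable_pi_apply k))
  have hφim : Measurable φi := measurable_pi_lambda _ fun i =>
    (measurable_pi_apply i).div (measurable_const.sub (Finset.measurable_sum _ fun j _ => measurable_pi_apply j))
  have hxm : ∀ i : Fin (n + 1), Measurable fun θ : Fin n → ℝ => (Fin.snoc θ (-∑ k, θ k) : Fin (n + 1) → ℝ) i := by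
    intro i
    induction i using Fin.lastCases with
    | last =>
      simp only [Fin.snoc_last]
      exact (Finset.measurable_sum _ fun k _ => measurable_pi_apply k).neg
    | cast k =>
      simp only [Fin.snoc_castSucc]
      exact measurable_pi_apply k
  have hζim : Measurable ζi := measurable_pi_lambda _ fun k => ((hxm _).sub (hxm _)).div measurable_const
  have hχm : Measurable χ := hχ.measurable
  have hJχm : Measurable Jχ := hχ.measurable_jac
  have hDm : Measurable fun a : Fin n → ℝ => ENNReal.ofReal |∏ i : Fin n, ∏ j ∈ Finset.Iio i, (1 - a j)| :=
    ENNReal.measurable_ofReal.comp ((continuous_finsetProd _ fun i _ => continuous_finsetProd _ fun j _ =>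
      continuous_const.sub (continuous_apply j)).measurable.abs)
  -- the alcove flow and its Jacobian
  set G : (Fin n → ℝ) → (Fin n → ℝ) := fun θ => Z (φ (χ (φi (ζi θ)))) with hG
  set JA : (Fin n → ℝ) → ℝ≥0∞ := fun θ =>
    ENNReal.ofReal |∏ i : Fin n, ∏ j ∈ Finset.Iio i, (1 - (χ (φi (ζi θ))) j)| * Jχ (φi (ζi θ)) /
      ENNReal.ofReal |∏ i : Fin n, ∏ j ∈ Finset.Iio i, (1 - (φi (ζi θ)) j)| with hJA
  have hGm : Measurable G := hZm.comp (hφm.comp (hχm.comp (hφim.comp hζim)))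
  have hdens : Measurable fun a : Fin n → ℝ =>
      ENNReal.ofReal |∏ i : Fin n, ∏ j ∈ Finset.Iio i, (1 - (χ a) j)| * Jχ a /
        ENNReal.ofReal |∏ i : Fin n, ∏ j ∈ Finset.Iio i, (1 - a j)| := ((hDm.comp hχm).mul hJχm).div hDm
  have hJAm : Measurable JA := hdens.comp (hφim.comp hζim)
  -- points of the alcove in box coordinates
  have hbox : ∀ θ : Fin n → ℝ, StrictMono (Fin.snoc θ (-∑ k, θ k) : Fin (n + 1) → ℝ) →
      (Fin.snoc θ (-∑ k, θ k) : Fin (n + 1) → ℝ) (Fin.last n) < (Fin.snoc θ (-∑ k, θ k) : Fin (n + 1) → ℝ) 0 + 2 * π →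
        φi (ζi θ) ∈ Set.pi univ (fun _ : Fin n => Ioo (0 : ℝ) 1) ∧ Z (φ (φi (ζi θ))) = θ := by
    intro θ h0 h1
    obtain ⟨a, ha, rfl⟩ := exists_box_of_mem_alcove_sun hφ hZ h0 h1
    rw [hleftζ, hleftφ a ha]
    exact ⟨ha, rfl⟩
  -- `HasJacobian (Leb|_A) G JA` through the two charts
  have hGJ : HasJacobian ((volume : Measure (Fin n → ℝ)).restrict
      {θ : Fin n → ℝ | StrictMono (Fin.snoc θ (-∑ k, θ k) : Fin (n + 1) → ℝ) ∧
        (Fin.snoc θ (-∑ k, θ k) : Fin (n + 1) → ℝ) (Fin.last n) <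
          (Fin.snoc θ (-∑ k, θ k) : Fin (n + 1) → ℝ) 0 + 2 * π}) G JA := by
    refine hasJacobian_alcove_of_simplexFlow_sun hZ
      (hasJacobian_simplex_of_boxFlow_sun hφ hχ (G := fun ρ => φ (χ (φi ρ))) (hφm.comp (hχm.comp hφim))
        (JG := fun ρ => ENNReal.ofReal |∏ i : Fin n, ∏ j ∈ Finset.Iio i, (1 - (χ (φi ρ)) j)| * Jχ (φi ρ) /
          ENNReal.ofReal |∏ i : Fin n, ∏ j ∈ Finset.Iio i, (1 - (φi ρ) j)|) (hdens.comp hφim) ?_ ?_)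
      hGm hJAm ?_ ?_
    · refine (ae_restrict_iff' (measurableSet_openBox_sun (n := n))).mpr (Filter.Eventually.of_forall fun a ha => ?_)
      show φ (χ (φi (φ a))) = φ (χ a)
      rw [hleftφ a ha]
    · refine (ae_restrict_iff' (measurableSet_openBox_sun (n := n))).mpr (Filter.Eventually.of_forall fun a ha => ?_)
      show ENNReal.ofReal |∏ i : Fin n, ∏ j ∈ Finset.Iio i, (1 - (χ (φi (φ a))) j)| * Jχ (φi (φ a)) /
          ENNReal.ofReal |∏ i : Fin n, ∏ j ∈ Finset.Iio i, (1 - (φi (φ a)) j)| = _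
      rw [hleftφ a ha]
    · refine Filter.Eventually.of_forall fun ρ => ?_
      show Z (φ (χ (φi (ζi (Z ρ))))) = Z (φ (χ (φi ρ)))
      rw [hleftζ]
    · refine Filter.Eventually.of_forall fun ρ => ?_
      show ENNReal.ofReal |∏ i : Fin n, ∏ j ∈ Finset.Iio i, (1 - (χ (φi (ζi (Z ρ)))) j)| * Jχ (φi (ζi (Z ρ))) /
          ENNReal.ofReal |∏ i : Fin n, ∏ j ∈ Finset.Iio i, (1 - (φi (ζi (Z ρ))) j)| = _
      rw [hleftζ]
  -- the hypotheses of the booked kernel theorem at `θ = Z(φ a)`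
  have hGA : ∀ θ : Fin n → ℝ, StrictMono (Fin.snoc θ (-∑ k, θ k) : Fin (n + 1) → ℝ) →
      (Fin.snoc θ (-∑ k, θ k) : Fin (n + 1) → ℝ) (Fin.last n) < (Fin.snoc θ (-∑ k, θ k) : Fin (n + 1) → ℝ) 0 + 2 * π →
        StrictMono (Fin.snoc (G θ) (-∑ k, (G θ) k) : Fin (n + 1) → ℝ) ∧
          (Fin.snoc (G θ) (-∑ k, (G θ) k) : Fin (n + 1) → ℝ) (Fin.last n) <
            (Fin.snoc (G θ) (-∑ k, (G θ) k) : Fin (n + 1) → ℝ) 0 + 2 * π := by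
    intro θ h0 h1
    exact gapChart_stickBreaking_mem_alcove_sun hφ hZ (hχbox _ (hbox θ h0 h1).1)
  have hfG' : ∀ θ : Fin n → ℝ, StrictMono (Fin.snoc θ (-∑ k, θ k) : Fin (n + 1) → ℝ) →
      (Fin.snoc θ (-∑ k, θ k) : Fin (n + 1) → ℝ) (Fin.last n) < (Fin.snoc θ (-∑ k, θ k) : Fin (n + 1) → ℝ) 0 + 2 * π →
        f (fun i => (Circle.exp ((Fin.snoc θ (-∑ k, θ k) : Fin (n + 1) → ℝ) i) : ℂ)) =
          fun i => (Circle.exp ((Fin.snoc (G θ) (-∑ k, (G θ) k) : Fin (n + 1) → ℝ) i) : ℂ) := by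
    intro θ h0 h1
    obtain ⟨ha, hθ⟩ := hbox θ h0 h1
    have h := hfG _ ha
    rw [hθ] at h
    exact h
  have hJchart' : ∀ θ : Fin n → ℝ, StrictMono (Fin.snoc θ (-∑ k, θ k) : Fin (n + 1) → ℝ) →
      (Fin.snoc θ (-∑ k, θ k) : Fin (n + 1) → ℝ) (Fin.last n) < (Fin.snoc θ (-∑ k, θ k) : Fin (n + 1) → ℝ) 0 + 2 * π →
      JD (fun i => (Circle.exp ((Fin.snoc θ (-∑ k, θ k) : Fin (n + 1) → ℝ) i) : ℂ)) * ENNReal.ofReal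
          ((∏ i, ∏ k ∈ Finset.univ.erase i,
            ‖(Circle.exp ((Fin.snoc θ (-∑ k, θ k) : Fin (n + 1) → ℝ) i) : ℂ) -
              (Circle.exp ((Fin.snoc θ (-∑ k, θ k) : Fin (n + 1) → ℝ) k) : ℂ)‖) / (Fintype.card (Fin (n + 1))).factorial) =
        JA θ * ENNReal.ofReal
          ((∏ i, ∏ k ∈ Finset.univ.erase i,
            ‖(Circle.exp ((Fin.snoc (G θ) (-∑ k, (G θ) k) : Fin (n + 1) → ℝ) i) : ℂ) -
              (Circle.exp ((Fin.snoc (G θ) (-∑ k, (G θ) k) : Fin (n + 1) → ℝ) k) : ℂ)‖) /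
                (Fintype.card (Fin (n + 1))).factorial) := by
    intro θ h0 h1
    obtain ⟨ha, hθ⟩ := hbox θ h0 h1
    have h := hJchart _ ha
    rw [hθ] at h
    exact h
  exact hasJacobian_spectralKernel_sun_booked hE hP hfm hfperm hGJ hGA hfG' hagree hf1 hfdet hJDm hJDperm hJchart' hJspec

end Booked

end Summit.Ventures.LatticeQCDFlow.Exactness
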